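import Summits.KontsevichZagierPeriods.KontsevichZagierPeriods.Theorems.RootDecompWalshStrataHtypeConicConst

/-!
# Root decomposition (Walsh strata), part 58 — H-type XIII: conic-edge family, linear radicand; head

The sub-family `E′ = (m + q₂²)e − mq₁² = 0`, `q₀ ≠ 0` of the degenerate conic-edge residual: then
`q₁ ≠ 0`, `F′ = −2mq₀q₁ ≠ 0` and the radicand `Δ = F′x + G′` is LINEAR.  The proof is that of the generic
case (part 54: `peel_rat` on the hull `[0, 1]`, on a rational hull `[lo, 1]` beyond the vertex, or with the
pole-cancelled vertex numerators) with the Euler terminal `sqrt_rational_div` replaced by the LANDED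
`InBaker.linear_factor` (no hull condition: `N/Q/√Δ = N/(QΔ)·√Δ`, `Δ > 0` on the domain) —
`InBaker.linear_rational_div`.  Together with part 57 this shrinks the conic-edge residual to its
PERFECT-SQUARE radicands `R-HCx°°` (`E′ ≠ 0`, `4E′G′ = F′²`):
`quadricBakerDescent_of_residuals₁₀ : R-HCx°° → R-Eθ → …Theses.RootDecompWalshStrata.QuadricBakerDescent`.

References: [KontsevichZagier2001 §1.2 rules (1)–(3)], [BCR1998 §2.2].
-/

noncomputable section

open Set MeasureTheory MvPolynomial Literature.NumberTheory.Transcendental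
open Literature.ModelTheory.ExponentialFields (IsSemialgebraic isSemialgebraic_univ isSemialgebraic_empty)
open Summit.KontsevichZagierPeriods.RootDecompWalshStrata.ConicDescent.VertexChart

namespace Summit.KontsevichZagierPeriods.RootDecompWalshStrata.ConicDescent.BallCube

/-! #### 58.1 The linear-radicand Euler terminal in `N/Q/√Δ` form -/

/-- `N/Q/√(fx + g)` with `f ≠ 0`, `Q ≠ 0` and `fx + g > 0` on the domain is in the Baker sector:
`N/Q/√Δ = N/(Q·Δ)·√Δ` and the LANDED `InBaker.linear_factor`. [KontsevichZagier2001 §1.2 rule (2); this node] -/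
theorem InBaker.linear_rational_div (f g : ℚ) (hf : f ≠ 0) (N Q : Polynomial ℚ) (r : KZ.IntegralRep 1)
    (hQ : ∀ v ∈ r.domain, Polynomial.aeval (v 0) Q ≠ 0)
    (hD : ∀ v ∈ r.domain, 0 < qD 0 f g (v 0))
    (hr : EqOn r.integrand (fun v => Polynomial.aeval (v 0) N / Polynomial.aeval (v 0) Q /
      √(qD 0 f g (v 0))) r.domain) :
    InBaker (KZ.of r) := by
  have hQD : ∀ x : ℝ, Polynomial.aeval x (Q * (Polynomial.C f * Polynomial.X + Polynomial.C g)) =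
      Polynomial.aeval x Q * qD 0 f g x := fun x => by
    simp only [map_mul, map_add, Polynomial.aeval_C, Polynomial.aeval_X, eq_ratCast, qD]
    push_cast
    ring
  refine InBaker.linear_factor f g hf N (Q * (Polynomial.C f * Polynomial.X + Polynomial.C g)) r
    (fun v hv => ?_) fun v hv => ?_
  · rw [hQD]
    exact mul_ne_zero (hQ v hv) (hD v hv).ne'
  · obtain ⟨u, hu⟩ : ∃ u : ℝ, u = √(qD 0 f g (v 0)) := ⟨_, rfl⟩
    have hDv := hD v hv
    have hu0 : u ≠ 0 := by rw [hu]; exact (Real.sqrt_pos.2 hDv).ne'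
    have hu2 : u ^ 2 = qD 0 f g (v 0) := by rw [hu]; exact Real.sq_sqrt hDv.le
    rw [hr hv]
    dsimp only
    rw [hQD, ← hu, div_div, div_mul_eq_mul_div,
      div_eq_div_iff (mul_ne_zero (hQ v hv) hu0) (mul_ne_zero (hQ v hv) hDv.ne')]
    linear_combination (-(Polynomial.aeval (v 0) N * Polynomial.aeval (v 0) Q)) * hu2

/-! #### 58.2 The conic-edge family with linear radicand (`E′ = 0`, `q₀ ≠ 0`) -/

/-- **Conic-edge family, LINEAR radicand** (`E′ = 0`, `q₀ ≠ 0`, hence `q₁ ≠ 0`, `F′ ≠ 0`): the generic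
recipe of part 54 with `InBaker.linear_rational_div` as terminal. [KontsevichZagier2001 §1.2 rules (1)–(3);
this node] -/
theorem InBaker.of_HCx_linear (e g m γ q0 q1 q2 s : ℚ) (he : 0 < e) (hm : 1 ≤ m) (hs : s = 1 ∨ s = -1)
    (hE0 : (m + q2 ^ 2) * e - m * q1 ^ 2 = 0) (hq0 : q0 ≠ 0)
    (S : Set (Fin 1 → ℝ)) (hS : IsSemialgebraic ℚ S)
    (hdom : ∀ t ∈ S, (0 ≤ t 0 ∧ t 0 ≤ 1) ∧ 0 < (e : ℝ) * t 0 ^ 2 + g ∧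
      0 < ((m : ℝ) + q2 ^ 2) * ((e : ℝ) * t 0 ^ 2 + g) - m * ((q0 : ℝ) + q1 * t 0) ^ 2)
    (r : KZ.IntegralRep 1) (hrd : r.domain = S)
    (hri : EqOn r.integrand (fun t => (γ : ℝ) * ((e : ℝ) / 3 * t 0 ^ 3 + g * t 0) * ((q1 : ℝ) * g - e * q0 * t 0) *
      ((m : ℝ) * ((q0 : ℝ) + q1 * t 0) +
        s * q2 * √(((m : ℝ) + q2 ^ 2) * ((e : ℝ) * t 0 ^ 2 + g) - m * ((q0 : ℝ) + q1 * t 0) ^ 2)) ^ 2 /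
      (((e : ℝ) * t 0 ^ 2 + g) ^ 2 *
        √(((m : ℝ) + q2 ^ 2) * ((e : ℝ) * t 0 ^ 2 + g) - m * ((q0 : ℝ) + q1 * t 0) ^ 2))) S) :
    InBaker (KZ.of r) := by
  have _hS := hS
  subst hrd
  have he0 : (0 : ℝ) < e := by exact_mod_cast he
  have hm0 : (0 : ℝ) < m := by exact_mod_cast zero_lt_one.trans_le hm
  have hs2 : (s : ℝ) ^ 2 = 1 := by rcases hs with h | h <;> simp [h]
  have hm0Q : 0 < m := zero_lt_one.trans_le hm
  have hq1 : q1 ≠ 0 := by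
    rintro rfl
    have h1 : (m + q2 ^ 2) * e = 0 := by linear_combination hE0
    have h2 : 0 < (m + q2 ^ 2) * e := by positivity
    linarith
  have hF : -(2 * m * q0 * q1) ≠ 0 :=
    neg_ne_zero.2 (mul_ne_zero (mul_ne_zero (mul_ne_zero two_ne_zero hm0Q.ne') hq0) hq1)
  have hI01 : ∀ v ∈ r.domain, ((0 : ℚ) : ℝ) ≤ v 0 ∧ v 0 ≤ ((1 : ℚ) : ℝ) := fun v hv => by
    obtain ⟨⟨h0, h1⟩, -⟩ := hdom v hv
    exact ⟨by exact_mod_cast h0, by exact_mod_cast h1⟩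
  -- the vertex `x⋆ = √(-g/e)` (relevant for `g ≤ 0` only)
  obtain ⟨xs, hxs⟩ : ∃ xs : ℝ, xs = √(-(g : ℝ) / e) := ⟨_, rfl⟩
  have hxs0 : 0 ≤ xs := by rw [hxs]; exact Real.sqrt_nonneg _
  by_cases hvx : g ≤ 0 ∧ (q0 : ℝ) + q1 * xs = 0
  · -- `g ≤ 0` and `ℓ` vanishes at the vertex point
    obtain ⟨hg, hlam⟩ := hvx
    have hg0 : (g : ℝ) ≤ 0 := by exact_mod_cast hg
    have hxs2 : xs ^ 2 = -(g : ℝ) / e := by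
      rw [hxs, Real.sq_sqrt (div_nonneg (neg_nonneg.2 hg0) he0.le)]
    rcases eq_or_ne q1 0 with hq1 | hq1
    · -- `q₁ = 0`, hence `q₀ = 0`: `n ≡ 0`, the integrand vanishes identically
      subst hq1
      have hq0 : (q0 : ℝ) = 0 := by simpa using hlam
      have hq0' : q0 = 0 := by exact_mod_cast hq0
      subst hq0'
      exact InBaker.of_eqOn_ratCast r 0 fun v hv => by rw [hri hv]; simp
    · obtain ⟨ρ, hρ⟩ : ∃ ρ : ℚ, q0 = -(q1 * ρ) := ⟨-q0 / q1, by field_simp⟩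
      subst hρ
      have hq1r : (q1 : ℝ) ≠ 0 := by exact_mod_cast hq1
      have hxsρ : xs = ρ := by
        push_cast at hlam
        have h1 : (q1 : ℝ) * (xs - ρ) = 0 := by linarith
        rcases mul_eq_zero.1 h1 with h2 | h2
        · exact absurd h2 hq1r
        · linarith
      subst hxsρ
      have hgρr : (g : ℝ) = -(e * ρ ^ 2) := by
        have h1 := hxs2
        field_simp at h1
        linarith
      have hgρ : g = -(e * ρ ^ 2) := by exact_mod_cast hgρr
      subst hgρ
      rcases eq_or_ne ρ 0 with hρ0 | hρ0
      · subst hρ0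
        exact InBaker.of_eqOn_ratCast r 0 fun v hv => by rw [hri hv]; simp
      · have hρpos : (0 : ℝ) < ρ := lt_of_le_of_ne hxs0 (Ne.symm (by exact_mod_cast hρ0))
        have hQv : ∀ x : ℝ, ((0 : ℚ) : ℝ) ≤ x → x ≤ ((1 : ℚ) : ℝ) → Polynomial.aeval x (hLxQv e ρ) ≠ 0 := by
          intro x hx _
          have hx0 : (0 : ℝ) ≤ x := by exact_mod_cast hx
          rw [aeval_hLxQv]
          positivity
        refine InBaker.peel_rat (hCxNAv e m γ q1 q2 s ρ) (hLxQv e ρ) 0 1 hQv r hI01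
          (fun v => Polynomial.aeval (v 0) (hCxNBv e m γ q1 q2 ρ) / Polynomial.aeval (v 0) (hLxQv e ρ) /
            √(qD ((m + q2 ^ 2) * e - m * q1 ^ 2) (-(2 * m * -(q1 * ρ) * q1))
              ((m + q2 ^ 2) * -(e * ρ ^ 2) - m * (-(q1 * ρ)) ^ 2) (v 0)))
          (fun v hv => ?_) fun rB hBd hBi => by
            rw [hE0] at hBi
            exact InBaker.linear_rational_div _ _ hF (hCxNBv e m γ q1 q2 ρ) (hLxQv e ρ) rB
              (fun v hv => hQv (v 0) (hI01 v (by rw [hBd] at hv; exact hv)).1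
                (hI01 v (by rw [hBd] at hv; exact hv)).2)
              (fun v hv => by
                have h3 := (hdom v (by rw [hBd] at hv; exact hv)).2.2
                rw [hCx_rad, hE0] at h3
                exact h3) hBi
        -- the integrand identity in the vertex case
        obtain ⟨⟨h0, -⟩, hH, hΔ⟩ := hdom v hv
        have hpos : 0 < qD ((m + q2 ^ 2) * e - m * q1 ^ 2) (-(2 * m * -(q1 * ρ) * q1))
            ((m + q2 ^ 2) * -(e * ρ ^ 2) - m * (-(q1 * ρ)) ^ 2) (v 0) := by
          rw [← hCx_rad]; exact hΔ
        obtain ⟨w, hw⟩ : ∃ w : ℝ, w = √(qD ((m + q2 ^ 2) * e - m * q1 ^ 2) (-(2 * m * -(q1 * ρ) * q1))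
            ((m + q2 ^ 2) * -(e * ρ ^ 2) - m * (-(q1 * ρ)) ^ 2) (v 0)) := ⟨_, rfl⟩
        have hw0 : w ≠ 0 := by rw [hw]; exact (Real.sqrt_pos.2 hpos).ne'
        have hw2 : w ^ 2 = ((m : ℝ) + q2 ^ 2) * ((e : ℝ) * v 0 ^ 2 + ((-(e * ρ ^ 2) : ℚ) : ℝ)) -
            m * ((((-(q1 * ρ)) : ℚ) : ℝ) + q1 * v 0) ^ 2 := by
          rw [hw, Real.sq_sqrt hpos.le, ← hCx_rad]
        have hD : ((e : ℝ) * v 0 ^ 2 + ((-(e * ρ ^ 2) : ℚ) : ℝ)) ^ 2 ≠ 0 := pow_ne_zero 2 hH.ne'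
        have hQ0 : (e : ℝ) * (v 0 + ρ) ^ 2 ≠ 0 := by positivity
        rw [hri hv]
        dsimp only
        rw [hCx_rad, ← hw, aeval_hCxNAv, aeval_hCxNBv, aeval_hLxQv, div_div,
          ← mul_div_mul_right (2 * (s : ℝ) * m * q2 * γ * q1 ^ 2 * ρ *
            ((e : ℝ) / 3 * v 0 ^ 3 + -((e : ℝ) * ρ ^ 2) * v 0)) ((e : ℝ) * (v 0 + ρ) ^ 2) hw0, ← add_div,
          div_eq_div_iff (mul_ne_zero hD hw0) (mul_ne_zero hQ0 hw0)]
        push_cast at hw2 ⊢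
        linear_combination ((γ : ℝ) * q1 * ρ * ((e : ℝ) / 3 * v 0 ^ 3 + -((e : ℝ) * ρ ^ 2) * v 0) * (e : ℝ) ^ 2 *
            (v 0 + ρ) ^ 2 * w * (q2 : ℝ) ^ 2 * (v 0 - ρ) * w ^ 2) * hs2 +
          ((γ : ℝ) * q1 * ρ * ((e : ℝ) / 3 * v 0 ^ 3 + -((e : ℝ) * ρ ^ 2) * v 0) * (e : ℝ) ^ 2 *
            (v 0 + ρ) ^ 2 * w * (q2 : ℝ) ^ 2 * (v 0 - ρ)) * hw2
  · -- a rational hull `[lo, 1]` free of zeros of `H`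
    obtain ⟨lo, hQh, hdomh⟩ : ∃ lo : ℚ,
        (∀ x : ℝ, (lo : ℝ) ≤ x → x ≤ ((1 : ℚ) : ℝ) → Polynomial.aeval x (hP e g ^ 2) ≠ 0) ∧
        (∀ v ∈ r.domain, (lo : ℝ) ≤ v 0 ∧ v 0 ≤ ((1 : ℚ) : ℝ)) := by
      rcases lt_or_ge 0 g with hg | hg
      · -- `g > 0`: hull `[0, 1]`
        have hg0 : (0 : ℝ) < g := by exact_mod_cast hg
        refine ⟨0, fun x hx _ => ?_, hI01⟩
        have hx0 : (0 : ℝ) ≤ x := by exact_mod_cast hx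
        rw [map_pow, aeval_hP]
        exact pow_ne_zero 2 (add_pos_of_nonneg_of_pos (mul_nonneg he0.le (sq_nonneg x)) hg0).ne'
      · -- `g ≤ 0`, `ℓ(x⋆) ≠ 0`: `Δ(x⋆) < 0` and the domain stays away from `x⋆`
        have hlam : (q0 : ℝ) + q1 * xs ≠ 0 := fun h => hvx ⟨hg, h⟩
        have hg0 : (g : ℝ) ≤ 0 := by exact_mod_cast hg
        have hxs2 : xs ^ 2 = -(g : ℝ) / e := by
          rw [hxs, Real.sq_sqrt (div_nonneg (neg_nonneg.2 hg0) he0.le)]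
        have hexs : (e : ℝ) * xs ^ 2 + g = 0 := by
          rw [hxs2]; field_simp; ring
        have hgt : ∀ v ∈ r.domain, xs < v 0 := fun v hv => by
          obtain ⟨⟨h0, -⟩, hH, -⟩ := hdom v hv
          have hv0 : 0 < v 0 := lt_of_le_of_ne h0 fun h => by
            rw [← h] at hH; norm_num at hH; linarith
          rw [hxs, Real.sqrt_lt' hv0, div_lt_iff₀ he0]
          nlinarith
        have hq2 : (0 : ℝ) ≤ (q2 : ℝ) ^ 2 := sq_nonneg _
        have hDxs : ((m : ℝ) + q2 ^ 2) * ((e : ℝ) * xs ^ 2 + g) - m * ((q0 : ℝ) + q1 * xs) ^ 2 < 0 := by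
          have h2 : 0 < ((q0 : ℝ) + q1 * xs) ^ 2 :=
            lt_of_le_of_ne (sq_nonneg _) (Ne.symm (pow_ne_zero 2 hlam))
          rw [hexs, mul_zero, zero_sub]
          exact neg_neg_of_pos (mul_pos hm0 h2)
        have hcont : Continuous fun x : ℝ =>
            ((m : ℝ) + q2 ^ 2) * ((e : ℝ) * x ^ 2 + g) - m * ((q0 : ℝ) + q1 * x) ^ 2 := by
          fun_prop
        obtain ⟨ε, hε, hball⟩ := Metric.eventually_nhds_iff.1
          (hcont.continuousAt.eventually_lt continuousAt_const hDxs)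
        obtain ⟨lo, hlo1, hlo2⟩ := exists_rat_btwn (show xs < xs + ε by linarith)
        have hge : ∀ v ∈ r.domain, xs + ε ≤ v 0 := fun v hv => by
          obtain ⟨-, -, hΔ⟩ := hdom v hv
          refine not_lt.1 fun hlt => ?_
          have hd : dist (v 0) xs < ε := by
            rw [Real.dist_eq, abs_of_pos (sub_pos.2 (hgt v hv))]; linarith
          have h1 := hball hd
          linarith
        refine ⟨lo, fun x hx _ => ?_, fun v hv => ?_⟩
        · rw [map_pow, aeval_hP]
          have hx0 : xs < x := by linarith
          have h1 : xs ^ 2 < x ^ 2 := by nlinarith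
          rw [hxs2, div_lt_iff₀ he0] at h1
          exact pow_ne_zero 2 (show (0 : ℝ) < e * x ^ 2 + g by nlinarith).ne'
        · obtain ⟨⟨-, h1⟩, -⟩ := hdom v hv
          exact ⟨by linarith [hge v hv], by exact_mod_cast h1⟩
    refine InBaker.peel_rat (hCxNA e g m γ q0 q1 q2 s) (hP e g ^ 2) lo 1 hQh r hdomh
      (fun v => Polynomial.aeval (v 0) (hCxNB e g m γ q0 q1 q2) / Polynomial.aeval (v 0) (hP e g ^ 2) /
        √(qD ((m + q2 ^ 2) * e - m * q1 ^ 2) (-(2 * m * q0 * q1)) ((m + q2 ^ 2) * g - m * q0 ^ 2) (v 0)))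
      (fun v hv => ?_) fun rB hBd hBi => by
        rw [hE0] at hBi
        exact InBaker.linear_rational_div _ _ hF (hCxNB e g m γ q0 q1 q2) (hP e g ^ 2) rB
          (fun v hv => hQh (v 0) (hdomh v (by rw [hBd] at hv; exact hv)).1
            (hdomh v (by rw [hBd] at hv; exact hv)).2)
          (fun v hv => by
            have h3 := (hdom v (by rw [hBd] at hv; exact hv)).2.2
            rw [hCx_rad, hE0] at h3
            exact h3) hBi
    -- the integrand identity
    obtain ⟨⟨h0, -⟩, hH, hΔ⟩ := hdom v hv
    have hpos : 0 < qD ((m + q2 ^ 2) * e - m * q1 ^ 2) (-(2 * m * q0 * q1)) ((m + q2 ^ 2) * g - m * q0 ^ 2)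
        (v 0) := by
      rw [← hCx_rad]; exact hΔ
    obtain ⟨w, hw⟩ : ∃ w : ℝ, w = √(qD ((m + q2 ^ 2) * e - m * q1 ^ 2) (-(2 * m * q0 * q1))
        ((m + q2 ^ 2) * g - m * q0 ^ 2) (v 0)) := ⟨_, rfl⟩
    have hw0 : w ≠ 0 := by rw [hw]; exact (Real.sqrt_pos.2 hpos).ne'
    have hw2 : w ^ 2 = ((m : ℝ) + q2 ^ 2) * ((e : ℝ) * v 0 ^ 2 + g) - m * ((q0 : ℝ) + q1 * v 0) ^ 2 := by
      rw [hw, Real.sq_sqrt hpos.le, ← hCx_rad]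
    have hD : ((e : ℝ) * v 0 ^ 2 + g) ^ 2 ≠ 0 := pow_ne_zero 2 hH.ne'
    rw [hri hv]
    dsimp only
    rw [hCx_rad, ← hw, aeval_hCxNA, aeval_hCxNB, map_pow, aeval_hP, div_div,
      ← mul_div_mul_right (2 * (s : ℝ) * m * q2 * γ * ((e : ℝ) / 3 * v 0 ^ 3 + g * v 0) *
        ((q1 : ℝ) * g - e * q0 * v 0) * ((q0 : ℝ) + q1 * v 0)) (((e : ℝ) * v 0 ^ 2 + g) ^ 2) hw0, ← add_div,
      div_left_inj' (mul_ne_zero hD hw0)]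
    linear_combination ((γ : ℝ) * ((e : ℝ) / 3 * v 0 ^ 3 + g * v 0) *
        ((q1 : ℝ) * g - e * q0 * v 0) * (q2 : ℝ) ^ 2 * w ^ 2) * hs2 +
      ((γ : ℝ) * ((e : ℝ) / 3 * v 0 ^ 3 + g * v 0) *
        ((q1 : ℝ) * g - e * q0 * v 0) * (q2 : ℝ) ^ 2) * hw2

/-! #### 58.3 Dispatcher and head -/

/-- **`R-HCx°° → R-HCx°`**: for `E′ = 0` the degenerate conic-edge family is `of_HCx_const` (`q₀ = 0`) or
`of_HCx_linear` (`q₀ ≠ 0`); the PERFECT-SQUARE radicands (`E′ ≠ 0`, `4E′G′ = F′²`) remain. [this node] -/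
theorem InBaker.of_Hconics_xd
    (hdeg : (∀ (e g m γ q0 q1 q2 s : ℚ), 0 < e → 1 ≤ m → (s = 1 ∨ s = -1) → (m + q2 ^ 2) * e - m * q1 ^ 2 ≠ 0 →
      ((m + q2 ^ 2) * e - m * q1 ^ 2) *
          (4 * ((m + q2 ^ 2) * e - m * q1 ^ 2) * ((m + q2 ^ 2) * g - m * q0 ^ 2) - (2 * m * q0 * q1) ^ 2) = 0 →
      ∀ (S : Set (Fin 1 → ℝ)), IsSemialgebraic ℚ S →
        (∀ t ∈ S, (0 ≤ t 0 ∧ t 0 ≤ 1) ∧ 0 < (e : ℝ) * t 0 ^ 2 + g ∧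
          0 < ((m : ℝ) + q2 ^ 2) * ((e : ℝ) * t 0 ^ 2 + g) - m * ((q0 : ℝ) + q1 * t 0) ^ 2) →
        ∀ r : KZ.IntegralRep 1, r.domain = S →
          EqOn r.integrand (fun t => (γ : ℝ) * ((e : ℝ) / 3 * t 0 ^ 3 + g * t 0) * ((q1 : ℝ) * g - e * q0 * t 0) *
            ((m : ℝ) * ((q0 : ℝ) + q1 * t 0) +
              s * q2 * √(((m : ℝ) + q2 ^ 2) * ((e : ℝ) * t 0 ^ 2 + g) - m * ((q0 : ℝ) + q1 * t 0) ^ 2)) ^ 2 /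
            (((e : ℝ) * t 0 ^ 2 + g) ^ 2 *
              √(((m : ℝ) + q2 ^ 2) * ((e : ℝ) * t 0 ^ 2 + g) - m * ((q0 : ℝ) + q1 * t 0) ^ 2))) S →
          InBaker (KZ.of r))) :
    (∀ (e g m γ q0 q1 q2 s : ℚ), 0 < e → 1 ≤ m → (s = 1 ∨ s = -1) →
      ((m + q2 ^ 2) * e - m * q1 ^ 2) *
          (4 * ((m + q2 ^ 2) * e - m * q1 ^ 2) * ((m + q2 ^ 2) * g - m * q0 ^ 2) - (2 * m * q0 * q1) ^ 2) = 0 →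
      ∀ (S : Set (Fin 1 → ℝ)), IsSemialgebraic ℚ S →
        (∀ t ∈ S, (0 ≤ t 0 ∧ t 0 ≤ 1) ∧ 0 < (e : ℝ) * t 0 ^ 2 + g ∧
          0 < ((m : ℝ) + q2 ^ 2) * ((e : ℝ) * t 0 ^ 2 + g) - m * ((q0 : ℝ) + q1 * t 0) ^ 2) →
        ∀ r : KZ.IntegralRep 1, r.domain = S →
          EqOn r.integrand (fun t => (γ : ℝ) * ((e : ℝ) / 3 * t 0 ^ 3 + g * t 0) * ((q1 : ℝ) * g - e * q0 * t 0) *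
            ((m : ℝ) * ((q0 : ℝ) + q1 * t 0) +
              s * q2 * √(((m : ℝ) + q2 ^ 2) * ((e : ℝ) * t 0 ^ 2 + g) - m * ((q0 : ℝ) + q1 * t 0) ^ 2)) ^ 2 /
            (((e : ℝ) * t 0 ^ 2 + g) ^ 2 *
              √(((m : ℝ) + q2 ^ 2) * ((e : ℝ) * t 0 ^ 2 + g) - m * ((q0 : ℝ) + q1 * t 0) ^ 2))) S →
          InBaker (KZ.of r)) := by
  intro e g m γ q0 q1 q2 s he hm hs hdisc S hS hdom r hrd hri
  by_cases hE0 : (m + q2 ^ 2) * e - m * q1 ^ 2 = 0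
  · by_cases hq0 : q0 = 0
    · exact InBaker.of_HCx_const e g m γ q0 q1 q2 s he hm hs hE0 hq0 S hS hdom r hrd hri
    · exact InBaker.of_HCx_linear e g m γ q0 q1 q2 s he hm hs hE0 hq0 S hS hdom r hrd hri
  · exact hdeg e g m γ q0 q1 q2 s he hm hs hE0 hdisc S hS hdom r hrd hri

/-- **`QuadricBakerDescent` from two typed residuals, v10.**  As `quadricBakerDescent_of_residuals₉`
(part 56) with the conic-edge residual shrunk to `R-HCx°°` = its PERFECT-SQUARE radicands
(`E′ = (m + q₂²)e − mq₁² ≠ 0`, `4E′G′ = F′²`, i.e. `Δ = E′(x − ρ)²`, `ρ = mq₀q₁/E′ ∈ ℚ`); blueprint for it: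
sign pieces `x ≷ ρ`, `√Δ = ±√E′(x − ρ)`, expand `(mℓ + sq₂√Δ)²/√Δ = m²ℓ²/(±√E′(x−ρ)) + 2smq₂ℓ + q₂²·(±√E′)(x−ρ)`,
split off the residue `A/(x − ρ)·√E′` (LANDED `sqrt_const_pole E′ ρ A`), and send the regular part `W/H²·√E′`
to `sqrt_const_even` (even part) and `of_Hodd_chart` (odd part).  [KontsevichZagier2001 §1.2; this node] -/
theorem quadricBakerDescent_of_residuals₁₀
    (hc : (∀ (e g m γ q0 q1 q2 s : ℚ), 0 < e → 1 ≤ m → (s = 1 ∨ s = -1) → (m + q2 ^ 2) * e - m * q1 ^ 2 ≠ 0 →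
      ((m + q2 ^ 2) * e - m * q1 ^ 2) *
          (4 * ((m + q2 ^ 2) * e - m * q1 ^ 2) * ((m + q2 ^ 2) * g - m * q0 ^ 2) - (2 * m * q0 * q1) ^ 2) = 0 →
      ∀ (S : Set (Fin 1 → ℝ)), IsSemialgebraic ℚ S →
        (∀ t ∈ S, (0 ≤ t 0 ∧ t 0 ≤ 1) ∧ 0 < (e : ℝ) * t 0 ^ 2 + g ∧
          0 < ((m : ℝ) + q2 ^ 2) * ((e : ℝ) * t 0 ^ 2 + g) - m * ((q0 : ℝ) + q1 * t 0) ^ 2) →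
        ∀ r : KZ.IntegralRep 1, r.domain = S →
          EqOn r.integrand (fun t => (γ : ℝ) * ((e : ℝ) / 3 * t 0 ^ 3 + g * t 0) * ((q1 : ℝ) * g - e * q0 * t 0) *
            ((m : ℝ) * ((q0 : ℝ) + q1 * t 0) +
              s * q2 * √(((m : ℝ) + q2 ^ 2) * ((e : ℝ) * t 0 ^ 2 + g) - m * ((q0 : ℝ) + q1 * t 0) ^ 2)) ^ 2 /
            (((e : ℝ) * t 0 ^ 2 + g) ^ 2 *
              √(((m : ℝ) + q2 ^ 2) * ((e : ℝ) * t 0 ^ 2 + g) - m * ((q0 : ℝ) + q1 * t 0) ^ 2))) S →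
          InBaker (KZ.of r)))
    (hθ : (∀ (L : Quadric₃) (ℓ₁ ℓ₂ g : Wall) (γ : ℚ) (σ : Fin 6 → SignType) (r : KZ.IntegralRep 2),
      0 < L.dq.disc →
      ¬((L.bwall ℓ₁).precomp L.dq.lagM.inv ∈ goodWalls 1 L.dq.eκ L.dq.d11 L.dq.cst ∧
          (L.bwall ℓ₂).precomp L.dq.lagM.inv ∈ goodWalls 1 L.dq.eκ L.dq.d11 L.dq.cst) →
      r.domain = atomFam (L.wfam ℓ₁ ℓ₂ g) σ →
      EqOn r.integrand (fun v => (γ : ℝ) * √(L.Dxy (v 0) (v 1))) r.domain → InBaker (KZ.of r))) :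
    Summit.KontsevichZagierPeriods.KontsevichZagierPeriods.Theses.RootDecompWalshStrata.QuadricBakerDescent :=
  quadricBakerDescent_of_residuals₉ (InBaker.of_Hconics_xd hc) hθ

end Summit.KontsevichZagierPeriods.RootDecompWalshStrata.ConicDescent.BallCube
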